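import Summits.FinalStateConjecture.FinalStateConjecture.Theorems.KerrShieldedDataExist.Negative.BentSliceConormal
import Literature.Geometry.Lorentzian.KerrSliceNormalRigidity
import HarnessLib

/-!
# `KerrShieldedDataExist`, line `plug-the-second-sheet` — the assembly, IV: the bent leaf near the junction

Support file (everything proved; no definitions, no named facts) for stub `stub_assembly` of crux
`stmt-FinalStateConjecture-10055`. Below `|y| < 4M` the hard-coded bent height vanishes identically
(`Negative.bentHeight_eq_zero_of_le`), so the crux's pinned graph `ψ = Negative.graph M 0 r₁` COINCIDES, near such
a point of `Kerr.slice 0 r₁`, with the Kerr–Schild slice embedding `y ↦ (0, y)`; hence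

* `mfderiv_graph_of_lt`, `inducedBilin_graph_of_lt` — `dψ = (0, ·)` and `ψ^* g = hRep M` there (Cook 2000, (55));
* `eq_sliceNormalRep_of_lt` — ANY future unit normal of `ψ` there IS the slice normal `Kerr.sliceNormalRep M`
  (uniqueness of the future unit normal, `Kerr.eq_sliceNormalRep`), and it agrees with it to first order
  (`fderiv_eq_sliceNormalRep_of_lt`);
* `secondFundamentalForm_graph_of_lt` — so its second fundamental form there is Cook's `kRep M`
  (`Kerr.secondFundamentalForm_eq_kRep_of_repr`).

This is why the leaf zone of the glued datum continues the Kerr–Schild zone `(hRep, kRep)` exactly.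
References: Cook, Living Rev. Relativ. 3 (2000) 5, §3.2.2; O'Neill 1983, Ch. 5, Lemma 5.26.
-/

-- the doubled `FinalStateConjecture` path component is the summit/problem naming scheme, not a mistake
set_option linter.dupNamespace false

noncomputable section

open Set Filter Topology TopologicalSpace
open scoped Manifold ContDiff Topology InnerProductSpace
open Literature.Geometry.Lorentzian
open Summit.FinalStateConjecture.FinalStateConjecture.Theorems.KerrShieldedDataExist

namespace Summit.FinalStateConjecture.FinalStateConjecture.Theorems.SwallowTheDatum

namespace Assembly

section LeafNear

variable {M r₁ : ℝ}

/-- Below `4M` the bent height of the graph vanishes at `y`. [folklore] -/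
theorem bentHeight_radius_eq_zero (hM : 0 < M) {y : E3} (hy : ‖y‖ ≤ 4 * M) :
    Negative.bentHeight M 0 (Kerr.radius 0 (E4.ofTimeSpace 0 y)) = 0 :=
  Negative.bentHeight_eq_zero_of_le hM (by rw [Kerr.radius_zero_ofTimeSpace]; exact hy)

/-- **Below `4M` the graph is the slice embedding near `y`** (as maps of the open submanifold `Kerr.slice 0 r₁`).
[folklore] -/
theorem graph_eventuallyEq_sliceEmbed (hM : 0 < M) {y : Kerr.slice 0 r₁} (hy : ‖(y : E3)‖ < 4 * M) :
    Negative.graph M 0 r₁ =ᶠ[𝓝 y] Kerr.sliceEmbed 0 r₁ := by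
  have hev : ∀ᶠ z : Kerr.slice 0 r₁ in 𝓝 y, ‖(z : E3)‖ < 4 * M :=
    (continuous_subtype_val.norm).continuousAt.eventually (Iio_mem_nhds hy)
  filter_upwards [hev] with z hz
  exact Negative.graph_eq_sliceEmbed_of_le hM (by rw [Kerr.radius_zero_ofTimeSpace]; exact hz.le)

/-- Below `4M` the coordinate representative of the graph is `z ↦ (0, z)` near `y`. [folklore] -/
theorem graphRep_eventuallyEq (hM : 0 < M) {y : E3} (hy : ‖y‖ < 4 * M) :
    (fun z : E3 ↦ E4.ofTimeSpace (Negative.bentHeight M 0 (Kerr.radius 0 (E4.ofTimeSpace 0 z))) z) =ᶠ[𝓝 y]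
      E4.ofTimeSpace 0 := by
  have hev : ∀ᶠ z : E3 in 𝓝 y, ‖z‖ < 4 * M := continuous_norm.continuousAt.eventually (Iio_mem_nhds hy)
  filter_upwards [hev] with z hz
  rw [bentHeight_radius_eq_zero hM hz.le]

/-- **Below `4M` the differential of the graph is `w ↦ (0, w)`.** [cite: Cook2000, §3.2.2] -/
theorem mfderiv_graph_of_lt (hM : 0 < M) {y : Kerr.slice 0 r₁} (hy : ‖(y : E3)‖ < 4 * M) (w : E3) :
    mfderiv 𝓘(ℝ, E3) 𝓘(ℝ, E4) (Negative.graph M 0 r₁) y w = E4.ofTimeSpace 0 w := by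
  rw [(graph_eventuallyEq_sliceEmbed hM hy).mfderiv_eq]
  exact Kerr.mfderiv_sliceEmbed_apply 0 r₁ y w

variable [Kerr.Facts]

/-- **Below `4M` the induced metric of the graph is Cook's `hRep M`** (`g((0,v),(0,w)) = hRep M y v w`,
`Kerr.bilin_zero_ofTimeSpace`). [cite: Cook2000, §3.2.2 (55)] -/
theorem inducedBilin_graph_of_lt (hM : 0 < M) {y : Kerr.slice 0 r₁} (hy : ‖(y : E3)‖ < 4 * M) (v w : E3) :
    (Kerr.smoothMetric M 0 r₁).inducedBilin 𝓘(ℝ, E3) (Negative.graph M 0 r₁) y v w = Kerr.hRep M y v w := by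
  have hy0 : (y : E3) ≠ 0 := Kerr.ne_zero_of_mem_slice_zero y
  rw [PseudoRiemannianMetric.inducedBilin_apply, mfderiv_graph_of_lt hM hy, mfderiv_graph_of_lt hM hy]
  have hgoal : Kerr.bilin M 0 (E4.ofTimeSpace (Negative.bentHeight M 0 (Kerr.radius 0 (E4.ofTimeSpace 0 (y : E3)))) y)
      (E4.ofTimeSpace 0 v) (E4.ofTimeSpace 0 w) = Kerr.hRep M y v w := by
    rw [bentHeight_radius_eq_zero hM hy.le]
    exact Kerr.bilin_zero_ofTimeSpace M hy0 v w
  exact hgoal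

variable {N₀ : E3 → E4}

/-- **Uniqueness of the future unit normal near the junction.** If `N₀` represents a future unit normal of the
graph (for the time orientation `V = −g♯dt*`), then below `4M` it IS the slice normal:
`N₀ y = Kerr.sliceNormalRep M y` (`Kerr.eq_sliceNormalRep`: normality to all `(0, w)`, `g(N, N) = −1` and
`g(V, N) < 0` pin the normal). [cite: Cook2000, §3.2.2] -/
theorem eq_sliceNormalRep_of_lt (hM : 0 ≤ M) (hM0 : 0 < M)
    (hν : (Kerr.smoothMetric M 0 r₁).IsFutureUnitNormal 𝓘(ℝ, E3) ((Kerr.timeOrientation M 0 r₁ hM).ofLE le_top)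
      (Negative.graph M 0 r₁) (fun y ↦ N₀ y))
    {y : Kerr.slice 0 r₁} (hy : ‖(y : E3)‖ < 4 * M) : N₀ y = Kerr.sliceNormalRep M y := by
  have hy0 : (y : E3) ≠ 0 := Kerr.ne_zero_of_mem_slice_zero y
  have hT0 := bentHeight_radius_eq_zero hM0 hy.le
  refine Kerr.eq_sliceNormalRep hM hy0 (fun w ↦ ?_) ?_ ?_
  · have h : Kerr.bilin M 0 (E4.ofTimeSpace (Negative.bentHeight M 0 (Kerr.radius 0 (E4.ofTimeSpace 0 (y : E3)))) y)
        (N₀ y) (mfderiv 𝓘(ℝ, E3) 𝓘(ℝ, E4) (Negative.graph M 0 r₁) y w) = 0 := hν.1.1 y w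
    rwa [mfderiv_graph_of_lt hM0 hy, hT0] at h
  · have h : Kerr.bilin M 0 (E4.ofTimeSpace (Negative.bentHeight M 0 (Kerr.radius 0 (E4.ofTimeSpace 0 (y : E3)))) y)
        (N₀ y) (N₀ y) = -1 := hν.1.2 y
    rwa [hT0] at h
  · have h := (hν.2 y).2
    rw [TimeOrientation.vectorField_ofLE] at h
    have h' : Kerr.bilin M 0 (E4.ofTimeSpace (Negative.bentHeight M 0 (Kerr.radius 0 (E4.ofTimeSpace 0 (y : E3)))) y)
        (Kerr.timeVector M 0
          (E4.ofTimeSpace (Negative.bentHeight M 0 (Kerr.radius 0 (E4.ofTimeSpace 0 (y : E3)))) y)) (N₀ y) < 0 := h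
    rwa [hT0] at h'

/-- Below `4M` the representative of the future unit normal agrees with the slice normal NEAR `y`, hence to first
order at `y`. [cite: Cook2000, §3.2.2] -/
theorem eventuallyEq_sliceNormalRep_of_lt (hM : 0 ≤ M) (hM0 : 0 < M)
    (hν : (Kerr.smoothMetric M 0 r₁).IsFutureUnitNormal 𝓘(ℝ, E3) ((Kerr.timeOrientation M 0 r₁ hM).ofLE le_top)
      (Negative.graph M 0 r₁) (fun y ↦ N₀ y))
    {y : Kerr.slice 0 r₁} (hy : ‖(y : E3)‖ < 4 * M) : N₀ =ᶠ[𝓝 (y : E3)] Kerr.sliceNormalRep M := by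
  have h1 : ∀ᶠ z : E3 in 𝓝 (y : E3), ‖z‖ < 4 * M := continuous_norm.continuousAt.eventually (Iio_mem_nhds hy)
  have h2 : ∀ᶠ z : E3 in 𝓝 (y : E3), z ∈ Kerr.slice 0 r₁ := (Kerr.slice 0 r₁).isOpen.mem_nhds y.2
  filter_upwards [h1, h2] with z hz hzs
  exact eq_sliceNormalRep_of_lt (y := ⟨z, hzs⟩) hM hM0 hν hz

/-- **Below `4M` the second fundamental form of the graph w.r.t. its future unit normal is Cook's `kRep M`.**
Both the graph and the normal agree to first order at `y` with the slice embedding and the slice normal, which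
is all the coordinate formula for `K` consumes (`Kerr.secondFundamentalForm_eq_kRep_of_repr`).
[cite: Cook2000, §3.2.2 (57)] -/
theorem secondFundamentalForm_graph_of_lt (hM : 0 ≤ M) (hM0 : 0 < M) [(Kerr.smoothMetric M 0 r₁).HasLeviCivita]
    (hν : (Kerr.smoothMetric M 0 r₁).IsFutureUnitNormal 𝓘(ℝ, E3) ((Kerr.timeOrientation M 0 r₁ hM).ofLE le_top)
      (Negative.graph M 0 r₁) (fun y ↦ N₀ y))
    (hN₀ : ContDiffOn ℝ ∞ N₀ (Kerr.slice 0 r₁ : Set E3))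
    {y : Kerr.slice 0 r₁} (hy : ‖(y : E3)‖ < 4 * M) (v w : E3) :
    (Kerr.smoothMetric M 0 r₁).secondFundamentalForm 𝓘(ℝ, E3) (Negative.graph M 0 r₁) (fun y ↦ N₀ y) y v w =
      Kerr.kRep M y v w := by
  have hrep := graphRep_eventuallyEq hM0 (y := (y : E3)) hy
  have hΦd : DifferentiableAt ℝ
      (fun z : E3 ↦ E4.ofTimeSpace (Negative.bentHeight M 0 (Kerr.radius 0 (E4.ofTimeSpace 0 z))) z) y :=
    (Kerr.hasFDerivAt_ofTimeSpace_zero _).differentiableAt.congr_of_eventuallyEq hrep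
  have hNd : DifferentiableAt ℝ N₀ y :=
    (hN₀.differentiableOn (by simp)).differentiableAt ((Kerr.slice 0 r₁).isOpen.mem_nhds y.2)
  have hfy : Negative.graph M 0 r₁ y = Kerr.sliceEmbed 0 r₁ y :=
    Negative.graph_eq_sliceEmbed_of_le hM0 (by rw [Kerr.radius_zero_ofTimeSpace]; exact hy.le)
  have hΦ' : ∀ u : E3, fderiv ℝ
      (fun z : E3 ↦ E4.ofTimeSpace (Negative.bentHeight M 0 (Kerr.radius 0 (E4.ofTimeSpace 0 z))) z) y u =
        E4.ofTimeSpace 0 u := fun u ↦ by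
    rw [hrep.fderiv_eq]; exact Kerr.fderiv_ofTimeSpace_zero _ u
  exact Kerr.secondFundamentalForm_eq_kRep_of_repr hM (f := Negative.graph M 0 r₁) (fun _ ↦ rfl)
    (ν := fun y ↦ N₀ y) (N := N₀) (fun _ ↦ rfl) hΦd hNd hfy hΦ' (eq_sliceNormalRep_of_lt hM hM0 hν hy)
    (eventuallyEq_sliceNormalRep_of_lt hM hM0 hν hy).fderiv_eq v w

end LeafNear

end Assembly

/-- **Registered export of this file** (sub-goal `assembly_leafNear` of stub `stub_assembly`): below `4M` the second
fundamental form of the bent graph w.r.t. any future unit normal is `kRep`, `Assembly.secondFundamentalForm_graph_of_lt`.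
[cite: Cook2000, §3.2.2 (57)] -/
theorem assembly_leafNear :
    ∀ [Kerr.Facts] (M r₁ : ℝ) (hM : 0 ≤ M), 0 < M → ∀ [(Kerr.smoothMetric M 0 r₁).HasLeviCivita] (N₀ : E3 → E4), (Kerr.smoothMetric M 0 r₁).IsFutureUnitNormal 𝓘(ℝ, E3) ((Kerr.timeOrientation M 0 r₁ hM).ofLE le_top) (Negative.graph M 0 r₁) (fun y ↦ N₀ y) → ContDiffOn ℝ ∞ N₀ (Kerr.slice 0 r₁ : Set E3) → ∀ (y : Kerr.slice 0 r₁), ‖(y : E3)‖ < 4 * M → ∀ (v w : E3), (Kerr.smoothMetric M 0 r₁).secondFundamentalForm 𝓘(ℝ, E3) (Negative.graph M 0 r₁) (fun y ↦ N₀ y) y v w = Kerr.kRep M y v w :=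
  fun _ _ hM hM0 _ _ hν hN₀ _ hy v w ↦ Assembly.secondFundamentalForm_graph_of_lt hM hM0 hν hN₀ hy v w

end Summit.FinalStateConjecture.FinalStateConjecture.Theorems.SwallowTheDatum

end
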